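import Literature.Barriers.Parity.SiegelZeroQuadraticPolynomialsCorollary1
import Literature.Barriers.Parity.SiegelZeroQuadraticPolynomialsHeathBrown
import HarnessLib

/-!
# Granville–Mollin's Theorem 4 and the corrected Corollary 1′ ∧ Theorem 3, discharged

Topic `Literature/Barriers/Parity`, companion of the catalogue entry
`SiegelZeroQuadraticPolynomials.lean` (Granville–Mollin, *Rabinowitsch revisited*, Acta Arith. 96
(2000)). Everything here is PROVED; no definition is introduced. With both exceptional-prime inputs
of §5C now theorems of the tree — `GranvilleMollin2000_eq5_5'_holds`
(`SiegelZeroQuadraticPolynomialsInputsProofs.lean`, the display before (5.5)) and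
`GranvilleMollin2000_heathBrownLemma3_holds` (`SiegelZeroQuadraticPolynomialsHeathBrown.lean`,
Heath-Brown's Lemma 3 in the `ω`-form) — the conditional assemblies of the tree close:

* `GranvilleMollin2000_thm4_holds` — **Theorem 4** ("Suppose that there is a Siegel zero for
  `L(s, (d/·))` with `η ≥ log|d|`, where `d ≡ 1 (mod 4)`. Then for `f(x) = x² + x + (1 − d)/4` we
  have `π_f(N) ∼ ϱ_d N` … uniformly in the range `d^{10} ≤ N ≤ d^{o(η)}`"), the named fact
  `Literature.Barriers.Parity.GranvilleMollin2000_thm4`, DISCHARGED through the tree's sieve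
  assembly `GranvilleMollin2000_thm4_of` (`SiegelZeroQuadraticPolynomialsTheorem4.lean`, §6A–6B);
* `GranvilleMollin2000_cor1'_thm3_odd_holds` — the corrected conjunction **Corollary 1′ ∧ Theorem 3**
  for `d ≡ 5 (mod 8)`, the named fact `Literature.Barriers.Parity.GranvilleMollin2000_cor1'_thm3_odd`
  (`SiegelZeroQuadraticPolynomialsCorollary1.lean`), DISCHARGED through
  `GranvilleMollin2000_cor1'_thm3_odd_of_eq5_5'` (Theorem 1 and Hecke's theorem being proved in the
  tree).

The remaining half of the catalogued barrier `SiegelZeroQuadraticPolynomials = Theorem 4 ∧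
Proposition 2` is Proposition 2 (`GranvilleMollin2000_prop2`).

[cite: GranvilleMollin2000, Theorem 4, §6A–6B; Corollary 1′ and Theorem 3]
-/

noncomputable section

namespace Literature.Barriers.Parity

/-- **Granville–Mollin 2000, Theorem 4, discharged** (`GranvilleMollin2000_thm4`): from the tree's
assembly `GranvilleMollin2000_thm4_of` and the two discharged §5C inputs
`GranvilleMollin2000_eq5_5'_holds`, `GranvilleMollin2000_heathBrownLemma3_holds`.
[cite: GranvilleMollin2000, Theorem 4 and §6A–6B] -/
theorem GranvilleMollin2000_thm4_holds : GranvilleMollin2000_thm4 :=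
  GranvilleMollin2000_thm4_of GranvilleMollin2000_eq5_5'_holds GranvilleMollin2000_heathBrownLemma3_holds

/-- **Granville–Mollin 2000, Corollary 1′ with Theorem 3 (corrected to `d ≡ 5 (mod 8)`),
discharged** (`GranvilleMollin2000_cor1'_thm3_odd`): from the tree's
`GranvilleMollin2000_cor1'_thm3_odd_of_eq5_5'` and the two discharged §5C inputs.
[cite: GranvilleMollin2000, Corollary 1′ and Theorem 3] -/
theorem GranvilleMollin2000_cor1'_thm3_odd_holds : GranvilleMollin2000_cor1'_thm3_odd :=
  GranvilleMollin2000_cor1'_thm3_odd_of_eq5_5' GranvilleMollin2000_eq5_5'_holds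
    GranvilleMollin2000_heathBrownLemma3_holds

end Literature.Barriers.Parity
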